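import Summits.QuantumFields.BalabanUV.Beta.GAN24.CombContactCellLetters
import Summits.QuantumFields.BalabanUV.Beta.GAN24.ContactCauchyCells

/-!
# `BalabanUV.Beta.GAN24.CombContactCauchyCells` — row G-an2-4 ∕ (CONV-C), TRANSFER-III, (III′) S-slot (b), the Wilson contact RATE END `hCTd′`, step CT-4e part 1 AT THE COMB CHART:
# **THE (III′) CONTACT TERM OF MEMBER `k` AS THE EXACT SIGNED COMBINATION OF ITS ATOMS** — six B-atoms (conjugated gauge reading × undressed leg × tent) and twelve P-atoms
# (tent × conjugated gauge reading × conjugated gauge jump), in the spelling of MY two-tower atom ENDs (`CombContactRefineBHolds`, `CombContactRefinePThreePack`) — the (III′)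
# twin of the OWNER gan24-p1 g22's (E) `ContactCauchyCells` §2: road-P2's M.59 cells `contact_combLegChain_ff_eq_cells` ⨾ the OWNER's generic `cellL_eq_atoms ∕ cellR_eq_atoms`
# and leaf-02's `cellIdx_eq'` BY NAME ⨾ MY conjugated letters (`CombContactCellLetters`, `CombContactGaugeStaircase.abs_combGauge_le`) used ONLY qualitatively.

NOT IN PRINT; OUR BOOKKEEPING (leaf prover `b2b-balaban-gan24-formalise-leaf-01` gen 89; the OWNER's (E) text transformed BY NAME: `T ↦ T′`, `λ ↦ λ′`; [folklore] EQUALITIES only; 0 `def`,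
0 cited facts, 0 `def … : Prop`, 0 sorry).  HONEST FRAMING (verbatim): «discharging `BetaPertH` makes Bałaban's UV stability UNCONDITIONAL — a real constructive-QFT result; it is
NOT the continuum limit and NOT the Clay problem.»  HONEST DEPENDENCY (verbatim): «continuum YM on T⁴ ⇐ BetaPertH ∧ nine spine estimates (0/9 proved); BetaPertH ⇐ (D1) ∧ (D4) ∧
CAP+tail; G-an2-4 gates asym, D1 and NE2/3/4.»  **`contact_eq_atoms`** (`d = 3`, `2 ≤ Lc`, in-block roots `r, rr`, `m = 0`).  NO estimate; discharges NOTHING of `hCTd′` by itself;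
NEVER «G-an2-4 closed» as (CONV-C); NOT D1, NOT BetaPertH, NOT continuum, NOT Clay.  2026-08-28; no existing file touched.
-/

noncomputable section

open Finset
open scoped BigOperators
open Literature.MathematicalPhysics.QuantumFieldTheory
open Literature.MathematicalPhysics.QuantumFieldTheory.LatticeForm (quo)
open Literature.MathematicalPhysics.QuantumFieldTheory.Balaban1983to89
open Literature.MathematicalPhysics.QuantumFieldTheory.Balaban1983to89.Beta
open B4ContourShift (supNorm supNorm_nonneg)
open StepJetData (wilsonA)
open AffineAveraging (Form0 Form1 Site box toSite curv curvAdj)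
open AffineReproduction (contourSumAdj)
open KernelSpecInstance (wΦ)
open B6BondElimination (unitVec)
open KKTFluctuationKernel (delta1)
open BalabanCompositeJets (respStep)
open Summit.QuantumFields.BalabanUV.Beta.AxialProjectorBlockMean (bmGaugeAt)
open Summit.QuantumFields.BalabanUV.Beta.GAN24.Push4Iter (LegFam legChain)
open Summit.QuantumFields.BalabanUV.Beta.GAN24.RespStepBmDecompExact (respStepBmSeq)
open Summit.QuantumFields.BalabanUV.Beta.GAN24.RespStepBmDecompPsi (Psi)
open Summit.QuantumFields.BalabanUV.Beta.GAN24.Push3 (push₃)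
open Summit.QuantumFields.BalabanUV.Beta.GAN24.ContactOneGaugeCellBound (abs_le_of_env summable_of_env)
open Summit.QuantumFields.BalabanUV.Beta.GAN24.ContactOneGaugeCellTable (cell_eq' cellIdx_eq')
open Summit.QuantumFields.BalabanUV.Beta.GAN24.ContactCellSplit (split_tip split_mid)
open Summit.QuantumFields.BalabanUV.Beta.GAN24.ContactCellReduction (abs_le_of_env₁ summable_of_env₁)
open Summit.QuantumFields.BalabanUV.Beta.GAN24.ContactKernelCells (contact_legChain_ff_eq_cells)
open Summit.QuantumFields.BalabanUV.Beta.GAN24.ContactPartnerLetters (curvAdj_curv_respStep_one_eq_contourSumAdj respStep_pow_zero)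
open Summit.QuantumFields.BalabanUV.Beta.GAN24.ContactCellLetters (abs_gauge_le legChain_apply_eq curvAdj_curv_legChain_zero_eq_contourSumAdj)
open Summit.QuantumFields.BalabanUV.Beta.GAN24.ContactAssembly (exists_common_letters)
open Summit.QuantumFields.BalabanUV.Beta.SymCorrectorKernel (psiKS)
open Summit.QuantumFields.BalabanUV.Beta.SymCorrectorFace (faceWtSum faceWtSum_nonneg)
open Summit.QuantumFields.BalabanUV.Beta.GAN24.Push4 (legComp)
open Summit.QuantumFields.BalabanUV.Beta.GAN24.CombLegChainGauge (PsiFace)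
open Summit.QuantumFields.BalabanUV.Beta.GAN24.CombContactKernelCells (contact_combLegChain_ff_eq_cells)
open Summit.QuantumFields.BalabanUV.Beta.GAN24.CombContactGaugeStaircase (abs_combGauge_le)
open Summit.QuantumFields.BalabanUV.Beta.GAN24.CombContactCellLetters (combLegChain_apply_eq summable_combLegChain curvAdj_curv_combLegChain_zero_eq_contourSumAdj)
open Summit.QuantumFields.BalabanUV.Beta.GAN24.ContactCauchyCells (cellL_eq_atoms cellR_eq_atoms)

namespace Summit.QuantumFields.BalabanUV.Beta.GAN24.CombContactCauchyCells

section Three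

variable {Lc : ℕ} [NeZero Lc] {r rr : Fin (3 + 1) → ℕ}

/-- NOT IN PRINT; OUR BOOKKEEPING.  **THE CONTACT TERM OF MEMBER `k` OF THE CUBIC-WILSON SECTOR AS THE EXACT SIGNED COMBINATION OF ITS ATOMS**
(`d = 3`, `2 ≤ Lc`, in-block root `ρ = toSite rr`; `T = legChain (respStepBmSeq ρ Lc) 0 k`, `B = respStep 1 (Lc^(k+1))`, gauge functions
`λ_{μ,z} = Psi ρ Lc 0 k (delta1 μ z) − bmGaugeAt ρ (B μ z) Lc`, tents `t_{μ,z} = contourSumAdj (Lc^(k+1)) (fun l y ↦ wΦ l μ (y − z))`):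
`CONTACT = [½(A_tip(λ_{αx′}; B_{κ′u′}; t_{βz′}) + Σ_κ P_tip,κ(t_{βz′}; λ_{αx′}; λ_{κ′u′})) − ½(A_mid(λ_{αx′}; B_{βz′}; t_{κ′u′}) + Σ_b P_mid,b(t_{κ′u′}; λ_{αx′}; λ_{βz′}))]`
`− [½(A_tip(λ_{βz′}; B_{κ′u′}; t_{αx′}) + Σ_κ P_tip,κ(t_{αx′}; λ_{βz′}; λ_{κ′u′})) − ½·A_mid(λ_{βz′}; B_{αx′}; t_{κ′u′})]`
`+ [½·A_site(λ_{κ′u′}; B_{βz′}; t_{αx′}) − ½·A_site(λ_{κ′u′}; B_{αx′}; t_{βz′})]` — leaf-01 g58's three cells + §1 + leaf-02's `cellIdx_eq'`. -/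
theorem contact_eq_atoms (hLc : 2 ≤ Lc) (hr : r ∈ box (3 + 1) Lc) (hrr : rr ∈ box (3 + 1) Lc) (k : ℕ) (κ' : Fin (3 + 1)) (u' x' z' : Site (3 + 1)) (α β : Fin (3 + 1)) :
    push₃ (legChain (fun j => legComp (fun α x κ u => psiKS r Lc u x (Sum.inl κ) (Sum.inl α)) (respStepBmSeq (d := 3) (toSite rr) Lc j)) 0 k) (legChain (fun j => legComp (fun α x κ u => psiKS r Lc u x (Sum.inl κ) (Sum.inl α)) (respStepBmSeq (d := 3) (toSite rr) Lc j)) 0 k)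
        (legChain (fun j => legComp (fun α x κ u => psiKS r Lc u x (Sum.inl κ) (Sum.inl α)) (respStepBmSeq (d := 3) (toSite rr) Lc j)) 0 k) (wilsonA 3) κ' u' x' z' (Sum.inl α) (Sum.inl β)
      - push₃ (respStep (d := 3) 1 (Lc ^ (k + 1))) (respStep (d := 3) 1 (Lc ^ (k + 1))) (respStep (d := 3) 1 (Lc ^ (k + 1)))
        (wilsonA 3) κ' u' x' z' (Sum.inl α) (Sum.inl β)
      = ((1 / 2 : ℝ) * ((∑' x : Site (3 + 1), ∑ κ,
              (Psi (toSite rr) Lc 0 k (delta1 α x') + PsiFace r (toSite rr) Lc 0 k (delta1 α x') - bmGaugeAt (toSite rr) (respStep (d := 3) 1 (Lc ^ (k + 1)) α x') Lc) (x + unitVec κ)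
                * respStep (d := 3) 1 (Lc ^ (k + 1)) κ' u' κ x
                * contourSumAdj (Lc ^ (k + 1)) (fun l y => wΦ (N := Lc ^ (k + 1)) (d := 3) l β (y - z')) κ x)
            + ∑ κ, ∑' v : Site (3 + 1), contourSumAdj (Lc ^ (k + 1)) (fun l y => wΦ (N := Lc ^ (k + 1)) (d := 3) l β (y - z')) κ v
                * (Psi (toSite rr) Lc 0 k (delta1 α x') + PsiFace r (toSite rr) Lc 0 k (delta1 α x') - bmGaugeAt (toSite rr) (respStep (d := 3) 1 (Lc ^ (k + 1)) α x') Lc) (v + unitVec κ)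
                * ((Psi (toSite rr) Lc 0 k (delta1 κ' u') + PsiFace r (toSite rr) Lc 0 k (delta1 κ' u') - bmGaugeAt (toSite rr) (respStep (d := 3) 1 (Lc ^ (k + 1)) κ' u') Lc) (v + unitVec κ)
                  - (Psi (toSite rr) Lc 0 k (delta1 κ' u') + PsiFace r (toSite rr) Lc 0 k (delta1 κ' u') - bmGaugeAt (toSite rr) (respStep (d := 3) 1 (Lc ^ (k + 1)) κ' u') Lc) v))
          - (1 / 2 : ℝ) * ((∑' x : Site (3 + 1), ∑ κ,
              ((Psi (toSite rr) Lc 0 k (delta1 α x') + PsiFace r (toSite rr) Lc 0 k (delta1 α x') - bmGaugeAt (toSite rr) (respStep (d := 3) 1 (Lc ^ (k + 1)) α x') Lc) x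
                  + (Psi (toSite rr) Lc 0 k (delta1 α x') + PsiFace r (toSite rr) Lc 0 k (delta1 α x') - bmGaugeAt (toSite rr) (respStep (d := 3) 1 (Lc ^ (k + 1)) α x') Lc) (x + unitVec κ)) / 2
                * respStep (d := 3) 1 (Lc ^ (k + 1)) β z' κ x
                * contourSumAdj (Lc ^ (k + 1)) (fun l y => wΦ (N := Lc ^ (k + 1)) (d := 3) l κ' (y - u')) κ x)
            + ∑ κ, ∑' v : Site (3 + 1), contourSumAdj (Lc ^ (k + 1)) (fun l y => wΦ (N := Lc ^ (k + 1)) (d := 3) l κ' (y - u')) κ v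
                * (((Psi (toSite rr) Lc 0 k (delta1 α x') + PsiFace r (toSite rr) Lc 0 k (delta1 α x') - bmGaugeAt (toSite rr) (respStep (d := 3) 1 (Lc ^ (k + 1)) α x') Lc) v
                    + (Psi (toSite rr) Lc 0 k (delta1 α x') + PsiFace r (toSite rr) Lc 0 k (delta1 α x') - bmGaugeAt (toSite rr) (respStep (d := 3) 1 (Lc ^ (k + 1)) α x') Lc) (v + unitVec κ)) / 2)
                * ((Psi (toSite rr) Lc 0 k (delta1 β z') + PsiFace r (toSite rr) Lc 0 k (delta1 β z') - bmGaugeAt (toSite rr) (respStep (d := 3) 1 (Lc ^ (k + 1)) β z') Lc) (v + unitVec κ)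
                  - (Psi (toSite rr) Lc 0 k (delta1 β z') + PsiFace r (toSite rr) Lc 0 k (delta1 β z') - bmGaugeAt (toSite rr) (respStep (d := 3) 1 (Lc ^ (k + 1)) β z') Lc) v)))
        - ((1 / 2 : ℝ) * ((∑' x : Site (3 + 1), ∑ κ,
              (Psi (toSite rr) Lc 0 k (delta1 β z') + PsiFace r (toSite rr) Lc 0 k (delta1 β z') - bmGaugeAt (toSite rr) (respStep (d := 3) 1 (Lc ^ (k + 1)) β z') Lc) (x + unitVec κ)
                * respStep (d := 3) 1 (Lc ^ (k + 1)) κ' u' κ x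
                * contourSumAdj (Lc ^ (k + 1)) (fun l y => wΦ (N := Lc ^ (k + 1)) (d := 3) l α (y - x')) κ x)
            + ∑ κ, ∑' v : Site (3 + 1), contourSumAdj (Lc ^ (k + 1)) (fun l y => wΦ (N := Lc ^ (k + 1)) (d := 3) l α (y - x')) κ v
                * (Psi (toSite rr) Lc 0 k (delta1 β z') + PsiFace r (toSite rr) Lc 0 k (delta1 β z') - bmGaugeAt (toSite rr) (respStep (d := 3) 1 (Lc ^ (k + 1)) β z') Lc) (v + unitVec κ)
                * ((Psi (toSite rr) Lc 0 k (delta1 κ' u') + PsiFace r (toSite rr) Lc 0 k (delta1 κ' u') - bmGaugeAt (toSite rr) (respStep (d := 3) 1 (Lc ^ (k + 1)) κ' u') Lc) (v + unitVec κ)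
                  - (Psi (toSite rr) Lc 0 k (delta1 κ' u') + PsiFace r (toSite rr) Lc 0 k (delta1 κ' u') - bmGaugeAt (toSite rr) (respStep (d := 3) 1 (Lc ^ (k + 1)) κ' u') Lc) v))
          - (1 / 2 : ℝ) * (∑' x : Site (3 + 1), ∑ κ,
              ((Psi (toSite rr) Lc 0 k (delta1 β z') + PsiFace r (toSite rr) Lc 0 k (delta1 β z') - bmGaugeAt (toSite rr) (respStep (d := 3) 1 (Lc ^ (k + 1)) β z') Lc) x
                  + (Psi (toSite rr) Lc 0 k (delta1 β z') + PsiFace r (toSite rr) Lc 0 k (delta1 β z') - bmGaugeAt (toSite rr) (respStep (d := 3) 1 (Lc ^ (k + 1)) β z') Lc) (x + unitVec κ)) / 2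
                * respStep (d := 3) 1 (Lc ^ (k + 1)) α x' κ x
                * contourSumAdj (Lc ^ (k + 1)) (fun l y => wΦ (N := Lc ^ (k + 1)) (d := 3) l κ' (y - u')) κ x))
        + ((1 / 2 : ℝ) * (∑' x : Site (3 + 1), ∑ κ,
              (Psi (toSite rr) Lc 0 k (delta1 κ' u') + PsiFace r (toSite rr) Lc 0 k (delta1 κ' u') - bmGaugeAt (toSite rr) (respStep (d := 3) 1 (Lc ^ (k + 1)) κ' u') Lc) x
                * respStep (d := 3) 1 (Lc ^ (k + 1)) β z' κ x
                * contourSumAdj (Lc ^ (k + 1)) (fun l y => wΦ (N := Lc ^ (k + 1)) (d := 3) l α (y - x')) κ x)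
          - (1 / 2 : ℝ) * (∑' x : Site (3 + 1), ∑ κ,
              (Psi (toSite rr) Lc 0 k (delta1 κ' u') + PsiFace r (toSite rr) Lc 0 k (delta1 κ' u') - bmGaugeAt (toSite rr) (respStep (d := 3) 1 (Lc ^ (k + 1)) κ' u') Lc) x
                * respStep (d := 3) 1 (Lc ^ (k + 1)) α x' κ x
                * contourSumAdj (Lc ^ (k + 1)) (fun l y => wΦ (N := Lc ^ (k + 1)) (d := 3) l β (y - z')) κ x)) := by
  haveI : NeZero (Lc ^ (k + 1)) := ⟨pow_ne_zero _ (NeZero.ne Lc)⟩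
  have hL1 : 1 ≤ Lc := by omega
  have hN1' : 1 ≤ Lc ^ (k + 1) := Nat.one_le_pow _ _ (by omega)
  obtain ⟨κ₀, C, KE, Φ₀, hκ, hC, hKE, hΦ, hN1, -, -, ht⟩ := exists_common_letters (Lc := Lc) hLc
  -- the three cells, legs in the `respStep 1 (Lc^(k+1))` spelling
  have hcells := contact_combLegChain_ff_eq_cells hr hrr 0 k κ' u' x' z' α β
  simp only [respStep_pow_zero] at hcells
  rw [hcells]
  clear hcells
  -- names
  set N : ℕ := Lc ^ (k + 1) with hNdef
  set T : LegFam 3 := legChain (fun j => legComp (fun α x κ u => psiKS r Lc u x (Sum.inl κ) (Sum.inl α)) (respStepBmSeq (d := 3) (toSite rr) Lc j)) 0 k with hT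
  set B : LegFam 3 := respStep (d := 3) 1 (Lc ^ (k + 1)) with hB
  set ψα : Form0 (3 + 1) ℝ := Psi (toSite rr) Lc 0 k (delta1 α x') + PsiFace r (toSite rr) Lc 0 k (delta1 α x') - bmGaugeAt (toSite rr) (B α x') Lc with hψα
  set ψβ : Form0 (3 + 1) ℝ := Psi (toSite rr) Lc 0 k (delta1 β z') + PsiFace r (toSite rr) Lc 0 k (delta1 β z') - bmGaugeAt (toSite rr) (B β z') Lc with hψβ
  set ψκ : Form0 (3 + 1) ℝ := Psi (toSite rr) Lc 0 k (delta1 κ' u') + PsiFace r (toSite rr) Lc 0 k (delta1 κ' u') - bmGaugeAt (toSite rr) (B κ' u') Lc with hψκ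
  set tα : Form1 (3 + 1) ℝ := contourSumAdj N (fun l y => wΦ (N := N) (d := 3) l α (y - x')) with htα
  set tβ : Form1 (3 + 1) ℝ := contourSumAdj N (fun l y => wΦ (N := N) (d := 3) l β (y - z')) with htβ
  set tκ : Form1 (3 + 1) ℝ := contourSumAdj N (fun l y => wΦ (N := N) (d := 3) l κ' (y - u')) with htκ
  -- letters, qualitatively: boundedness and summability
  set Eψ : ℝ := 2 * (8 * (Lc : ℝ) * C * ((Lc : ℝ) ^ (5 * (k + 1)))⁻¹ + faceWtSum r Lc * ((1 + 8 * (Lc : ℝ) * (Real.exp κ₀ + 1)) * C * ((Lc : ℝ) ^ (5 * (k + 1)))⁻¹)) *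
      (Lc : ℝ) ^ (k + 1) with hEψ
  have hF0 := faceWtSum_nonneg r Lc
  set CB : ℝ := C * ((Lc : ℝ) ^ (5 * (k + 1)))⁻¹ with hCB
  set τ : ℝ := (N : ℕ) * (Φ₀ * ((Lc : ℝ) ^ (8 * (k + 1)))⁻¹) * Real.exp κ₀ with hτ
  have hEψ0 : 0 ≤ Eψ := by positivity
  have hCB0 : 0 ≤ CB := by positivity
  have hτ0 : 0 ≤ τ := by positivity
  have hψenv : ∀ (μ : Fin (3 + 1)) (z : Site (3 + 1)) (u : Site (3 + 1)),
      |Psi (toSite rr) Lc 0 k (delta1 μ z) u + PsiFace r (toSite rr) Lc 0 k (delta1 μ z) u - bmGaugeAt (toSite rr) (B μ z) Lc u| ≤ Eψ * Real.exp (-(κ₀ * supNorm (quo N u - z))) := by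
    intro μ z u
    have h := abs_combGauge_le hκ.le hC hN1 hr hrr le_rfl hLc 0 k μ z u
    simp only [respStep_pow_zero] at h
    exact h
  have hψb : ∀ (μ : Fin (3 + 1)) (z : Site (3 + 1)) (u : Site (3 + 1)),
      |Psi (toSite rr) Lc 0 k (delta1 μ z) u + PsiFace r (toSite rr) Lc 0 k (delta1 μ z) u - bmGaugeAt (toSite rr) (B μ z) Lc u| ≤ Eψ :=
    fun μ z u => abs_le_of_env (L := N) hκ.le hEψ0
      (g := fun u => Psi (toSite rr) Lc 0 k (delta1 μ z) u + PsiFace r (toSite rr) Lc 0 k (delta1 μ z) u - bmGaugeAt (toSite rr) (B μ z) Lc u) (hψenv μ z) u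
  have hTeq : ∀ (μ : Fin (3 + 1)) (z : Site (3 + 1)) (κ : Fin (3 + 1)) (u : Site (3 + 1)),
      T μ z κ u = B μ z κ u + ((Psi (toSite rr) Lc 0 k (delta1 μ z) + PsiFace r (toSite rr) Lc 0 k (delta1 μ z) - bmGaugeAt (toSite rr) (B μ z) Lc) (u + unitVec κ)
        - (Psi (toSite rr) Lc 0 k (delta1 μ z) + PsiFace r (toSite rr) Lc 0 k (delta1 μ z) - bmGaugeAt (toSite rr) (B μ z) Lc) u) := by
    intro μ z κ u
    have h := combLegChain_apply_eq hr hrr 0 k μ z κ u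
    simp only [respStep_pow_zero] at h
    exact h
  have hBenv : ∀ (μ : Fin (3 + 1)) (z : Site (3 + 1)) (κ : Fin (3 + 1)) (u : Site (3 + 1)),
      |B μ z κ u| ≤ CB * Real.exp (-(κ₀ * supNorm (quo N u - z))) := by
    intro μ z κ u
    have h := hN1 0 k μ z κ u
    simp only [respStep_pow_zero] at h
    exact h
  have hBb : ∀ (μ : Fin (3 + 1)) (z : Site (3 + 1)) (κ : Fin (3 + 1)) (u : Site (3 + 1)), |B μ z κ u| ≤ CB :=
    fun μ z => abs_le_of_env₁ hκ.le hCB0 (hBenv μ z)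
  have hBs : ∀ (μ : Fin (3 + 1)) (z : Site (3 + 1)) (κ : Fin (3 + 1)), Summable (B μ z κ) :=
    fun μ z => summable_of_env₁ hN1' hκ (hBenv μ z)
  have hTs : ∀ (μ : Fin (3 + 1)) (z : Site (3 + 1)) (b : Fin (3 + 1)), Summable (T μ z b) :=
    fun μ z b => summable_combLegChain hr hrr 0 k μ z b
  have hTb : ∀ (μ : Fin (3 + 1)) (z : Site (3 + 1)) (κ : Fin (3 + 1)) (u : Site (3 + 1)), |T μ z κ u| ≤ CB + 2 * Eψ := by
    intro μ z κ u
    rw [hTeq]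
    have h1 := hBb μ z κ u
    have h2 := hψb μ z (u + unitVec κ)
    have h3 := hψb μ z u
    have h4 := abs_add_le (B μ z κ u) ((Psi (toSite rr) Lc 0 k (delta1 μ z) + PsiFace r (toSite rr) Lc 0 k (delta1 μ z) - bmGaugeAt (toSite rr) (B μ z) Lc) (u + unitVec κ)
        - (Psi (toSite rr) Lc 0 k (delta1 μ z) + PsiFace r (toSite rr) Lc 0 k (delta1 μ z) - bmGaugeAt (toSite rr) (B μ z) Lc) u)
    have h5 := abs_sub ((Psi (toSite rr) Lc 0 k (delta1 μ z) + PsiFace r (toSite rr) Lc 0 k (delta1 μ z) - bmGaugeAt (toSite rr) (B μ z) Lc) (u + unitVec κ))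
      ((Psi (toSite rr) Lc 0 k (delta1 μ z) + PsiFace r (toSite rr) Lc 0 k (delta1 μ z) - bmGaugeAt (toSite rr) (B μ z) Lc) u)
    simp only [Pi.sub_apply, Pi.add_apply] at h4 h5 ⊢
    linarith
  have hMT : ∀ (μ : Fin (3 + 1)) (z : Site (3 + 1)),
      curvAdj (curv (T μ z)) = contourSumAdj N (fun l y => wΦ (N := N) (d := 3) l μ (y - z)) :=
    fun μ z => curvAdj_curv_combLegChain_zero_eq_contourSumAdj hr hrr k μ z
  have hMB : ∀ (μ : Fin (3 + 1)) (z : Site (3 + 1)),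
      curvAdj (curv (B μ z)) = contourSumAdj N (fun l y => wΦ (N := N) (d := 3) l μ (y - z)) :=
    fun μ z => curvAdj_curv_respStep_one_eq_contourSumAdj (N := N) μ z
  have htenv : ∀ (μ : Fin (3 + 1)) (z : Site (3 + 1)) (κ : Fin (3 + 1)) (u : Site (3 + 1)),
      |contourSumAdj N (fun l y => wΦ (N := N) (d := 3) l μ (y - z)) κ u| ≤ τ * Real.exp (-(κ₀ * supNorm (quo N u - z))) := by
    intro μ z κ u; have h := ht k μ z κ u; rw [hτ]; exact h
  have htb : ∀ (μ : Fin (3 + 1)) (z : Site (3 + 1)) (κ : Fin (3 + 1)) (u : Site (3 + 1)),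
      |contourSumAdj N (fun l y => wΦ (N := N) (d := 3) l μ (y - z)) κ u| ≤ τ :=
    fun μ z => abs_le_of_env₁ hκ.le hτ0 (htenv μ z)
  have hts : ∀ (μ : Fin (3 + 1)) (z : Site (3 + 1)) (κ : Fin (3 + 1)),
      Summable (contourSumAdj N (fun l y => wΦ (N := N) (d := 3) l μ (y - z)) κ) :=
    fun μ z => summable_of_env₁ hN1' hκ (htenv μ z)
  -- the three cells as atoms
  rw [cellL_eq_atoms (T₃ := T β z') (T₁ := T κ' u') (ψ := ψα) (B₁ := B κ' u') (B₃ := B β z') (lam₁ := ψκ) (lam₃ := ψβ) (M₁ := tκ) (M₃ := tβ)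
      (hTs β z') (hts κ' u') (hts β z') (hψb α x') (hTb κ' u') (hBb κ' u') (hBb β z') (hψb κ' u') (hψb β z') (htb κ' u')
      (hTeq κ' u') (hTeq β z') (hMT κ' u') (hMT β z'),
    cellR_eq_atoms (B₃ := B α x') (T₁ := T κ' u') (ψ := ψβ) (B₁ := B κ' u') (lam₁ := ψκ) (M₁ := tκ) (M₃ := tα)
      (hBs α x') (hts α x') (hψb β z') (hTb κ' u') (hBb κ' u') (hψb κ' u') (htb κ' u') (hTeq κ' u') (hMT κ' u') (hMB α x'),
    cellIdx_eq' (TR := B β z') (TL := B α x') (ψ := ψκ) (hBs β z') (hψb κ' u') (hBb α x')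
      (fun b z => by rw [hMB α x']; exact htb α x' b z),
    hMB α x', hMB β z']

end Three

end Summit.QuantumFields.BalabanUV.Beta.GAN24.CombContactCauchyCells

end
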